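import Mathlib
import Literature.Analysis.Convex.ConcaveAffineMajorants
import Summits.QuantumFields.QCD.Theses.EulerDescent

/-!
# Harnack-cone membership of the gap along a mass ray from its concave shape
(helper for crux `EulerDescent.RayDescent`, item stmt-QuantumFields-16900, line `Sketch`)

The open stub (M) `stub_harnackConeMembership` of line `Sketch` asserts that the volume-uniform
lattice gap along a mass ray `t ↦ t·m` (`t ≥ 1`) from the exact Wilson corner is, in the
`liminf`/slack sense of its four clauses, the trace on `[1, ∞)` of an INFIMUM OF NON-NEGATIVE
HARMONIC FUNCTIONS on the right half-plane `{Re t > 0}` ("Harnack-cone membership"), step by step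
in the coupling index `k`.  The disprover showed (p167257, `Negative/ConeMembershipUpwardLaw.lean`)
that such membership forces BOTH sharp chord laws (`g(x)/x` non-increasing — Euler descent — and
`x·g(x)` non-decreasing), and (`Literature.Analysis.Complex.not_harnackHull_max_one_half`) the two
chord laws do not suffice: the honest content of (M) is a concavity-type hull condition.

This file proves the positive half of that picture, in tree vocabulary and in (M)'s own `k`-indexed
form: **if at every step `k` the certified uniform rates along the ray are governed by a function
`g k` on `[1, ∞)` that is concave, non-decreasing and subhomogeneous (`g k x / x` non-increasing)
with `g k 1 ≥ 0` — every certified rate at `t·m` eventually `≤ g k t`, and every rate eventually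
and uniformly below `g k t` certified — then the four clauses of (M) hold for `(reg, m)`**
(`harnackConeConclusion_of_concaveShapes`; `…_of_concaveShape` is the `k`-independent case).  The
family is indexed by pairs `(d, b)`, `d, b ≥ 0`: `G k (d,b) = d + b·Re z` when `d + b·x`
majorises `g k` on `[1, ∞)`, and the always-available majorant `g k 1 · Re z` otherwise.  The
analysis is the tree lemma `Literature.Analysis.Convex.exists_affine_majorant_le_add`
(ε-supporting affine majorants with non-negative coefficients); `d + b·Re z = Re (d + b z)` is
harmonic and non-negative on the right half-plane.

Reading for the line: (M) is sandwiched between statements about the SHAPE of the gap function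
along rays — `[Euler descent ∧ monotone ∧ concave, eventually in k] ⟹ (M) ⟹ [Euler descent ∧
x·g(x) non-decreasing]` — so (M) exceeds the crux's exact-corner slice by at most ray-concavity plus
monotonicity of the gap in the quark mass, and by more than nothing.  No physics is proved here.
-/

noncomputable section

namespace Summit.QuantumFields.QCD.Theorems.RayDescentSketch

open Filter Set
open scoped Topology
open Literature.MathematicalPhysics.QuantumFieldTheory

/-- The affine function `z ↦ Re (d + b z) = d + b·Re z` is harmonic on every set (real part of an
entire function). [folklore] -/
theorem harmonicOnNhd_re_affine (d b : ℝ) (s : Set ℂ) :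
    InnerProductSpace.HarmonicOnNhd (fun z : ℂ => ((d : ℂ) + (b : ℂ) * z).re) s := by
  intro z _
  have h : AnalyticAt ℂ (fun z : ℂ => (d : ℂ) + (b : ℂ) * z) z := by fun_prop
  exact h.harmonicAt_re

/-- Value of the affine function: `Re (d + b z) = d + b·Re z`. [folklore] -/
theorem re_affine_apply (d b : ℝ) (z : ℂ) : ((d : ℂ) + (b : ℂ) * z).re = d + b * z.re := by
  simp [Complex.add_re, Complex.mul_re]

/-- **Harnack-cone membership of the uniform lattice gap along a mass ray from the concave shape of
the step-`k` gap functions** (helper for stub (M) `stub_harnackConeMembership` of line `Sketch`,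
in its `k`-indexed form).  Let `reg` be any regularisation, `m` any tuple, and suppose functions
`g k : ℝ → ℝ` govern the certified uniform lattice rates along the ray `t·m`, `t ≥ 1`: every
certified rate `Δ > 0` at `t·m` is eventually `≤ g k t`, and every rate `Δ > 0` with
`Δ + ε ≤ g k t` eventually in `k` (some `ε > 0`) is certified.  If each `g k` is concave and
non-decreasing on `[1, ∞)` with `t ↦ g k t / t` non-increasing and `g k 1 ≥ 0`, then the four
clauses of (M) hold for `(reg, m)` with the family, indexed by `(d, b) ∈ [0,∞)²`,
`G k (d,b) = d + b·Re z` if `d + b·x ≥ g k x` on `[1, ∞)` and `G k (d,b) = g k 1 · Re z` otherwise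
(a majorant by subhomogeneity).  Upper clause: `Δ ≤ g k t ≤ G k (d,b) t`; lower clause: at each
large `k` the tree lemma `Literature.Analysis.Convex.exists_affine_majorant_le_add` gives a
majorising pair with `d + b t ≤ g k t + ε/2`, whence `Δ + ε/2 ≤ g k t` eventually, certified.
[folklore] -/
theorem harnackConeConclusion_of_concaveShapes {Nf : ℕ} (reg : QCDRegularisation Nf)
    (m : Fin Nf → ℝ) (g : ℕ → ℝ → ℝ) (hconc : ∀ k, ConcaveOn ℝ (Ici 1) (g k))
    (hmono : ∀ k, MonotoneOn (g k) (Ici 1)) (hsub : ∀ k, AntitoneOn (fun x => g k x / x) (Ici 1))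
    (hg1 : ∀ k, 0 ≤ g k 1)
    (hupper : ∀ t : ℝ, 1 ≤ t → ∀ Δ : ℝ, 0 < Δ →
      (reg.scheme (fun f => t * m f) 0 0).HasLatticeMassGap Δ → ∀ᶠ k in atTop, Δ ≤ g k t)
    (hlower : ∀ t : ℝ, 1 ≤ t → ∀ Δ : ℝ, 0 < Δ → (∃ ε : ℝ, 0 < ε ∧ ∀ᶠ k in atTop, Δ + ε ≤ g k t) →
      (reg.scheme (fun f => t * m f) 0 0).HasLatticeMassGap Δ) :
    ∃ (ι : Type) (G : ℕ → ι → ℂ → ℝ),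
      (∀ k i, InnerProductSpace.HarmonicOnNhd (G k i) {z : ℂ | 0 < z.re}) ∧
      (∀ k i (z : ℂ), 0 < z.re → 0 ≤ G k i z) ∧
      (∀ t : ℝ, 1 ≤ t → ∀ Δ : ℝ, 0 < Δ →
        (reg.scheme (fun f => t * m f) 0 0).HasLatticeMassGap Δ →
          ∀ᶠ k in atTop, ∀ i, Δ ≤ G k i t) ∧
      (∀ t : ℝ, 1 ≤ t → ∀ Δ : ℝ, 0 < Δ →
        (∃ ε : ℝ, 0 < ε ∧ ∀ᶠ k in atTop, ∀ i, Δ + ε ≤ G k i t) →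
          (reg.scheme (fun f => t * m f) 0 0).HasLatticeMassGap Δ) := by
  classical
  -- subhomogeneity gives the always-available majorant `g k 1 · x`
  have hlin : ∀ k (x : ℝ), 1 ≤ x → g k x ≤ g k 1 * x := by
    intro k x hx
    have h : g k x / x ≤ g k 1 / 1 := hsub k (le_refl (1 : ℝ)) hx hx
    rw [div_one, div_le_iff₀ (by linarith)] at h
    exact h
  -- index set and family
  let ι : Type := {p : ℝ × ℝ // 0 ≤ p.1 ∧ 0 ≤ p.2}
  let Maj : ℕ → ι → Prop := fun k i => ∀ x : ℝ, 1 ≤ x → g k x ≤ i.1.1 + i.1.2 * x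
  let G : ℕ → ι → ℂ → ℝ := fun k i z =>
    if Maj k i then ((i.1.1 : ℂ) + (i.1.2 : ℂ) * z).re else (((0 : ℝ) : ℂ) + (g k 1 : ℂ) * z).re
  have hG : ∀ k i, G k i = fun z =>
      if Maj k i then ((i.1.1 : ℂ) + (i.1.2 : ℂ) * z).re
        else (((0 : ℝ) : ℂ) + (g k 1 : ℂ) * z).re := fun _ _ => rfl
  refine ⟨ι, G, ?_, ?_, ?_, ?_⟩
  · -- harmonic: affine in either branch
    intro k i
    by_cases h : Maj k i
    · have e : G k i = fun z => ((i.1.1 : ℂ) + (i.1.2 : ℂ) * z).re := by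
        rw [hG]; funext z; rw [if_pos h]
      rw [e]; exact harmonicOnNhd_re_affine _ _ _
    · have e : G k i = fun z => (((0 : ℝ) : ℂ) + (g k 1 : ℂ) * z).re := by
        rw [hG]; funext z; rw [if_neg h]
      rw [e]; exact harmonicOnNhd_re_affine _ _ _
  · -- non-negative on the right half-plane
    intro k i z hz
    show 0 ≤ (if Maj k i then ((i.1.1 : ℂ) + (i.1.2 : ℂ) * z).re
      else (((0 : ℝ) : ℂ) + (g k 1 : ℂ) * z).re)
    split_ifs
    · rw [re_affine_apply]; exact add_nonneg i.2.1 (mul_nonneg i.2.2 hz.le)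
    · rw [re_affine_apply, zero_add]; exact mul_nonneg (hg1 k) hz.le
  · -- upper clause
    intro t ht Δ hΔ hgap
    filter_upwards [hupper t ht Δ hΔ hgap] with k hk i
    show Δ ≤ (if Maj k i then ((i.1.1 : ℂ) + (i.1.2 : ℂ) * (t : ℂ)).re
      else (((0 : ℝ) : ℂ) + (g k 1 : ℂ) * (t : ℂ)).re)
    split_ifs with h
    · rw [re_affine_apply, Complex.ofReal_re]; exact hk.trans (h t ht)
    · rw [re_affine_apply, Complex.ofReal_re, zero_add]; exact hk.trans (hlin k t ht)
  · -- lower clause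
    rintro t ht Δ hΔ ⟨ε, hε, hev⟩
    refine hlower t ht Δ hΔ ⟨ε / 2, half_pos hε, ?_⟩
    filter_upwards [hev] with k hk
    obtain ⟨d, b, hd, hb, hmaj, hle⟩ :=
      Literature.Analysis.Convex.exists_affine_majorant_le_add one_pos (hconc k) (hmono k) (hsub k)
        (hg1 k) ht (half_pos hε)
    have hi := hk ⟨(d, b), hd, hb⟩
    have hM : Maj k ⟨(d, b), hd, hb⟩ := hmaj
    change Δ + ε ≤ (if Maj k ⟨(d, b), hd, hb⟩ then (((d : ℝ) : ℂ) + ((b : ℝ) : ℂ) * (t : ℂ)).re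
      else (((0 : ℝ) : ℂ) + (g k 1 : ℂ) * (t : ℂ)).re) at hi
    rw [if_pos hM, re_affine_apply, Complex.ofReal_re] at hi
    linarith

/-- **The `k`-independent case**: one concave, non-decreasing, subhomogeneous `g ≥ 0` governing
the certified rates along the ray (every certified `Δ` at `t·m` is `≤ g t`; every `0 < Δ < g t`
is certified) already yields the four clauses of (M) for `(reg, m)`. [folklore] -/
theorem harnackConeConclusion_of_concaveShape {Nf : ℕ} (reg : QCDRegularisation Nf)
    (m : Fin Nf → ℝ) (g : ℝ → ℝ) (hconc : ConcaveOn ℝ (Ici 1) g) (hmono : MonotoneOn g (Ici 1))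
    (hsub : AntitoneOn (fun x => g x / x) (Ici 1)) (hg1 : 0 ≤ g 1)
    (hupper : ∀ t : ℝ, 1 ≤ t → ∀ Δ : ℝ, 0 < Δ →
      (reg.scheme (fun f => t * m f) 0 0).HasLatticeMassGap Δ → Δ ≤ g t)
    (hlower : ∀ t : ℝ, 1 ≤ t → ∀ Δ : ℝ, 0 < Δ → Δ < g t →
      (reg.scheme (fun f => t * m f) 0 0).HasLatticeMassGap Δ) :
    ∃ (ι : Type) (G : ℕ → ι → ℂ → ℝ),
      (∀ k i, InnerProductSpace.HarmonicOnNhd (G k i) {z : ℂ | 0 < z.re}) ∧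
      (∀ k i (z : ℂ), 0 < z.re → 0 ≤ G k i z) ∧
      (∀ t : ℝ, 1 ≤ t → ∀ Δ : ℝ, 0 < Δ →
        (reg.scheme (fun f => t * m f) 0 0).HasLatticeMassGap Δ →
          ∀ᶠ k in atTop, ∀ i, Δ ≤ G k i t) ∧
      (∀ t : ℝ, 1 ≤ t → ∀ Δ : ℝ, 0 < Δ →
        (∃ ε : ℝ, 0 < ε ∧ ∀ᶠ k in atTop, ∀ i, Δ + ε ≤ G k i t) →
          (reg.scheme (fun f => t * m f) 0 0).HasLatticeMassGap Δ) := by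
  refine harnackConeConclusion_of_concaveShapes reg m (fun _ => g) (fun _ => hconc) (fun _ => hmono)
    (fun _ => hsub) (fun _ => hg1) (fun t ht Δ hΔ hgap => Eventually.of_forall fun _ =>
      hupper t ht Δ hΔ hgap) ?_
  rintro t ht Δ hΔ ⟨ε, hε, hev⟩
  obtain ⟨k, hk⟩ := hev.exists
  exact hlower t ht Δ hΔ (by simpa using (lt_add_of_pos_right Δ hε).trans_le hk)

end Summit.QuantumFields.QCD.Theorems.RayDescentSketch

end
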